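import Literature.AlgebraicGeometry.Resolution.FBlowup
import Literature.AlgebraicGeometry.Resolution.LipmanProcedure
import Literature.AlgebraicGeometry.Resolution.SurfaceResolutionReduction
import Literature.AlgebraicGeometry.Resolution.QuasiProjectiveResolution

/-!
# `WeightedThesis` / Kunz tower — normalised F-blowup towers exist

Support lemma for crux `stmt-ResolutionOfSingularities-0569`, line `kunz-tower-exceptional-defect`,
stub `stub_towerExists`. If every integral separated `k`-scheme of finite type (with function
field of characteristic `p`) has an `e`-th F-blowup (`IsFBlowup p e`, Yasuda 2012 =
arXiv:0706.2700, Def. 2.2 / Cor. 2.6, `FBlowup.lean`), then over every such `X₀` there is a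
NORMALISED F-BLOWUP TOWER of level `e`: `X : ℕ → Scheme`, `ρ n : X n ⟶ X₀`,
`π n : X (n+1) ⟶ X n` with `π n ≫ ρ n = ρ (n+1)`, `ρ 0` and every `π n` the normalisation of an
`e`-th F-blowup (up to an isomorphism of the source), all `X n` integral with function field of
characteristic `p`, and all `ρ n` proper and birational.

Proof: recursion on the stage. An F-blowup of a locally Noetherian integral scheme is integral,
proper and birational (`IsFBlowup.isIntegral/.isProper/.isBirational`); the normalisation of a
variety is finite (E. Noether, `isFinite_normalizationι`, `NoetherFiniteIntegralClosure_holds`)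
and birational (`isBirational_normalizationι`); so each new stage is again integral, proper and
birational over `X₀`, hence separated of finite type over `k`, and the hypothesis applies again
(the pattern of Lipman's procedure, `LipmanProcedure.lean`).
-/

noncomputable section

open CategoryTheory AlgebraicGeometry TopologicalSpace
open Literature.AlgebraicGeometry.Resolution

set_option linter.dupNamespace false

namespace Summit.ResolutionOfSingularities.ResolutionOfSingularities.Theorems.WeightedThesis.KunzTower

/-- The function field of an integral scheme over a field of characteristic `p` has
characteristic `p` (the structure map `k → K(X)` is a ring homomorphism of fields). [folklore] -/
theorem charP_functionField_of_hom {k : Type} [Field k] (p : ℕ) [CharP k p] {X : Scheme.{0}}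
    [IsIntegral X] (f : X ⟶ Spec (.of k)) : CharP X.functionField p := by
  haveI : Nonempty (⊤ : X.Opens) := by
    obtain ⟨x⟩ := (inferInstance : Nonempty X)
    exact ⟨⟨x, trivial⟩⟩
  let φ : k →+* X.functionField :=
    (X.germToFunctionField ⊤).hom.comp
      ((f.appTop).hom.comp (Scheme.ΓSpecIso (.of k)).commRingCatIsoToRingEquiv.symm.toRingHom)
  exact (RingHom.charP_iff_charP φ p).mp ‹_›

/-- The identity of a scheme is birational. [folklore] -/
theorem isBirational_id' (X : Scheme.{0}) : IsBirational (𝟙 X) :=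
  ⟨⊤, by simp [dense_univ], by simp [dense_univ], inferInstance⟩

/-- **One step of the normalised F-blowup tower.** Let `Z` be integral with function field of
characteristic `p`, proper and birational over `X₀`, itself separated of finite type over `k`.
If every integral separated `k`-scheme of finite type has an `e`-th F-blowup, then there is a
stage `Z' = (FB_e Z)^ν → Z` — the normalisation of an `e`-th F-blowup `g : Y → Z` — with `Z'`
integral, `K(Z')` of characteristic `p`, and `Z' → Z → X₀` proper and birational (the F-blowup is
proper birational, Yasuda 2012 Cor. 2.6; the normalisation of a variety is finite and
birational). [folklore] -/
theorem tower_step {p : ℕ} [Fact p.Prime] {k : Type} [Field k] [CharP k p] {e : ℕ}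
    (hex : ∀ (X : Scheme.{0}) (f : X ⟶ Spec (.of k)) [IsIntegral X] [IsSeparated f]
      [LocallyOfFiniteType f] [QuasiCompact f] [CharP X.functionField p],
      ∃ (Y : Scheme.{0}) (g : Y ⟶ X), IsFBlowup p e g)
    {X₀ : Scheme.{0}} (f : X₀ ⟶ Spec (.of k)) [IsSeparated f] [LocallyOfFiniteType f]
    [QuasiCompact f] (Z : Scheme.{0}) [IsIntegral Z] [CharP Z.functionField p] (r : Z ⟶ X₀)
    [IsProper r] (hr : IsBirational r) :
    ∃ (Z' : Scheme.{0}) (_ : IsIntegral Z') (_ : CharP Z'.functionField p) (r' : Z' ⟶ X₀)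
      (_ : IsProper r') (_ : IsBirational r') (π : Z' ⟶ Z), π ≫ r = r' ∧
      ∃ (Y : Scheme.{0}) (_ : IsIntegral Y) (g : Y ⟶ Z) (i : Z' ≅ normalization Y),
        IsFBlowup p e g ∧ π = i.hom ≫ normalizationι Y ≫ g := by
  haveI : IsLocallyNoetherian Z := LocallyOfFiniteType.isLocallyNoetherian (r ≫ f)
  obtain ⟨Y, g, hg⟩ := hex Z (r ≫ f)
  haveI : IsIntegral Y := hg.isIntegral
  haveI : IsProper g := hg.isProper
  haveI : IsFinite (normalizationι Y) :=
    isFinite_normalizationι Y NoetherFiniteIntegralClosure_holds (g ≫ r ≫ f)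
  have hb : IsBirational ((normalizationι Y ≫ g) ≫ r) :=
    ((isBirational_normalizationι Y (g ≫ r ≫ f)).comp hg.isBirational).comp hr
  exact ⟨normalization Y, inferInstance,
    charP_functionField_of_hom p (((normalizationι Y ≫ g) ≫ r) ≫ f),
    (normalizationι Y ≫ g) ≫ r, inferInstance, hb, normalizationι Y ≫ g, rfl,
    Y, inferInstance, g, Iso.refl _, hg, (Category.id_comp _).symm⟩

/-- **Normalised F-blowup towers exist** (stub `stub_towerExists` of line
`kunz-tower-exceptional-defect`): if every integral separated `k`-scheme of finite type (with
function field of characteristic `p`) has an `e`-th F-blowup, then over every such `X₀` there is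
a normalised F-blowup tower of level `e` — `X : ℕ → Scheme`, `ρ n : X n ⟶ X₀`,
`π n : X (n+1) ⟶ X n`, `π n ≫ ρ n = ρ (n+1)`, every `X n` integral with function field of
characteristic `p`, `ρ 0` and every `π n` the normalisation of an `e`-th F-blowup (up to an
isomorphism of the source) — all of whose structure maps `ρ n` are proper and birational
(recursion on `tower_step`). [cite: Yasuda2012, Def. 2.2 and Cor. 2.6] -/
theorem stub_towerExists :
    ∀ (p : ℕ) [Fact p.Prime] (k : Type) [Field k] [CharP k p] [PerfectField k] (e : ℕ), 0 < e →
      (∀ (X : Scheme.{0}) (f : X ⟶ Spec (.of k)) [IsIntegral X] [IsSeparated f]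
          [LocallyOfFiniteType f] [QuasiCompact f] [CharP X.functionField p],
          ∃ (Y : Scheme.{0}) (g : Y ⟶ X), IsFBlowup p e g) →
      ∀ (X₀ : Scheme.{0}) (f : X₀ ⟶ Spec (.of k)) [IsIntegral X₀] [IsSeparated f]
        [LocallyOfFiniteType f] [QuasiCompact f] [CharP X₀.functionField p],
      ∃ (X : ℕ → Scheme.{0}) (_ : ∀ n, IsIntegral (X n)) (_ : ∀ n, CharP (X n).functionField p)
        (ρ : ∀ n, X n ⟶ X₀) (π : ∀ n, X (n + 1) ⟶ X n),
        (∀ n, π n ≫ ρ n = ρ (n + 1)) ∧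
        (∃ (Y : Scheme.{0}) (_ : IsIntegral Y) (g : Y ⟶ X₀) (i : X 0 ≅ normalization Y),
            IsFBlowup p e g ∧ ρ 0 = i.hom ≫ normalizationι Y ≫ g) ∧
        (∀ n, ∃ (Y : Scheme.{0}) (_ : IsIntegral Y) (g : Y ⟶ X n) (i : X (n + 1) ≅ normalization Y),
            IsFBlowup p e g ∧ π n = i.hom ≫ normalizationι Y ≫ g) ∧
        (∀ n, IsProper (ρ n) ∧ IsBirational (ρ n)) := by
  intro p _ k _ _ _ e _ hex X₀ f _ _ _ _ _
  -- the stages: integral `Z`, `K(Z)` of characteristic `p`, proper and birational over `X₀`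
  let S : Type 1 := {s : Σ (Z : Scheme.{0}), (Z ⟶ X₀) //
    ∃ (_ : IsIntegral s.1), CharP s.1.functionField p ∧ IsProper s.2 ∧ IsBirational s.2}
  -- one step of the recursion, on bundled stages
  have step : ∀ s : S, haveI := s.2.fst; haveI := s.2.snd.1;
      ∃ (s' : S) (π : s'.1.1 ⟶ s.1.1), π ≫ s.1.2 = s'.1.2 ∧
        ∃ (Y : Scheme.{0}) (_ : IsIntegral Y) (g : Y ⟶ s.1.1) (i : s'.1.1 ≅ normalization Y),
          IsFBlowup p e g ∧ π = i.hom ≫ normalizationι Y ≫ g := by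
    rintro ⟨⟨Z, r⟩, hZ, hc, hr, hb⟩
    obtain ⟨Z', hZ', hc', r', hr', hb', π, hπ, Y, hY, g, i, hg, hπ'⟩ := tower_step hex f Z r hb
    exact ⟨⟨⟨Z', r'⟩, hZ', hc', hr', hb'⟩, π, hπ, Y, hY, g, i, hg, hπ'⟩
  choose F P hP hF using step
  -- the tower: iterate the step from `X₀` itself
  let base : S := ⟨⟨X₀, 𝟙 X₀⟩, ‹_›, ‹_›, inferInstance, isBirational_id' X₀⟩
  let T : ℕ → S := fun n => Nat.rec (motive := fun _ => S) (F base) (fun _ t => F t) n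
  refine ⟨fun n => (T n).1.1, fun n => (T n).2.fst, fun n => (T n).2.snd.1, fun n => (T n).1.2,
    fun n => P (T n), fun n => hP (T n), ?_, fun n => hF (T n), fun n => (T n).2.snd.2⟩
  -- stage `0` is the step applied to `X₀` with `ρ 0 = π ≫ 𝟙 X₀`
  obtain ⟨Y, hY, g, i, hg, hπ⟩ := hF base
  refine ⟨Y, hY, g, i, hg, ?_⟩
  have h0 : P base ≫ 𝟙 X₀ = (F base).1.2 := hP base
  rw [Category.comp_id] at h0
  change (F base).1.2 = _
  rw [← h0, hπ]

end Summit.ResolutionOfSingularities.ResolutionOfSingularities.Theorems.WeightedThesis.KunzTower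

end
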